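import Mathlib.Analysis.Normed.Group.Bounded
import Mathlib.MeasureTheory.Function.LpSeminorm.Basic
import Mathlib.Topology.Instances.Matrix
import Mathlib.Analysis.SpecialFunctions.Sqrt
import Literature.MathematicalPhysics.QuantumFieldTheory.UnevenAxialBlocking
import Literature.MathematicalPhysics.QuantumFieldTheory.LatticeGaugeProofs
import Literature.MathematicalPhysics.QuantumFieldTheory.BalabanBlockSpecification

/-!
# Crux `BrascampLiebVacuum` (stmt-QuantumFields-8779), line `per-scale-brascamp-lieb`
## Stub `stub_admissibleMemLp`

Link-Lipschitz test functions are bounded and continuous, hence square integrable.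
-/

open scoped BigOperators Topology Matrix
open Filter MeasureTheory
open Literature.MathematicalPhysics.QuantumFieldTheory
open Literature.MathematicalPhysics.QuantumLattice (transport pathEnd)

noncomputable section

namespace Summit.QuantumFields.YangMills.Theorems.BrascampLiebVacuum

/-- On a compact space carrying a finite Borel measure, a real function which is Lipschitz for a
pseudo-distance `D` that is continuous in its first slot and vanishes on the diagonal is continuous,
hence bounded, hence in `L²`. [folklore] -/
theorem psbl_memLp_two_of_lipschitz_pseudodist {X : Type*} [TopologicalSpace X] [CompactSpace X]
    [MeasurableSpace X] [OpensMeasurableSpace X] {μ : Measure X} [IsFiniteMeasure μ]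
    {f : X → ℝ} {K : ℝ} {D : X → X → ℝ} (hK : ∀ U V, |f U - f V| ≤ K * D U V)
    (hD : ∀ V, Continuous fun U => D U V) (hD0 : ∀ V, D V V = 0) : MemLp f 2 μ := by
  have hcont : Continuous f := by
    refine continuous_iff_continuousAt.2 fun V => ?_
    rw [ContinuousAt, tendsto_iff_norm_sub_tendsto_zero]
    refine squeeze_zero (fun U => norm_nonneg _)
      (fun U => (Real.norm_eq_abs _).le.trans (hK U V)) ?_
    exact (continuous_const.fun_mul (hD V)).tendsto' V 0 (by simp only [hD0 V, mul_zero])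
  obtain ⟨C, hC⟩ := isCompact_univ.exists_bound_of_continuousOn hcont.continuousOn
  exact MemLp.of_bound hcont.aestronglyMeasurable C (ae_of_all _ fun U => hC U (Set.mem_univ U))

/-- **Stub (MATHEMATICS — admissible test functions are square integrable).** A function of the
links which is Lipschitz for the Frobenius link metric pulled back by `r.ρ` is bounded and
continuous on the compact configuration space, hence in `L²` of Wilson's (probability) measure.
[folklore] -/
theorem stub_admissibleMemLp :
    ∀ (G : Type) [Group G] [TopologicalSpace G] [IsTopologicalGroup G] [CompactSpace G]
      [MeasurableSpace G] [BorelSpace G] (r : LatticeRep G) (β : ℝ) (S : ℕ),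
      let μ := wilsonMeasure (d := 4) (L := 2 * S + 1) r.ρ β
      let fro : Matrix (Fin r.N) (Fin r.N) ℂ → ℝ := fun M => ∑ a, ∑ b, ‖M a b‖ ^ 2
      ∀ f : GaugeConfig 4 (2 * S + 1) G → ℝ,
        (∃ K : ℝ, ∀ U V : GaugeConfig 4 (2 * S + 1) G,
          |f U - f V| ≤ K * ∑ e, Real.sqrt (fro (r.ρ (U e) - r.ρ (V e)))) →
        MemLp f 2 μ := by
  intro G _ _ _ _ _ _ r β S
  dsimp only
  intro f hf
  obtain ⟨K, hK⟩ := hf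
  haveI := r.secondCountableTopology
  haveI : IsProbabilityMeasure (wilsonMeasure (d := 4) (L := 2 * S + 1) r.ρ β) :=
    isProbabilityMeasure_wilsonMeasure (d := 4) (L := 2 * S + 1) r.ρ r.continuous β
  refine psbl_memLp_two_of_lipschitz_pseudodist hK (fun V => ?_) (fun V => ?_)
  · refine continuous_finsetSum _ fun e _ => ?_
    refine (continuous_finsetSum _ fun a _ => continuous_finsetSum _ fun b _ => ?_).sqrt
    have he : Continuous fun U : GaugeConfig 4 (2 * S + 1) G => U e := continuous_apply e
    exact (((r.continuous.comp' he).fun_sub continuous_const).matrix_elem a b).norm.fun_pow 2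
  · simp

end Summit.QuantumFields.YangMills.Theorems.BrascampLiebVacuum

end
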